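import Summits.Langlands.Langlands.Theses.IrreducibilityBySelfDuality
import Summits.Langlands.Langlands.Theorems.IrreducibilityBySelfDualityIrreducibleGL3CMContinuousSemisimplification
import Summits.Langlands.Langlands.Theorems.IrreducibilityBySelfDualityIrreducibleGL3CMCyclotomicUntwist
import Summits.Langlands.Langlands.Theorems.IrreducibilityBySelfDualityIrreducibleGL3CMReducibleCompanion
import Literature.NumberTheory.Automorphic.AlgebraicityParityGL
import Literature.NumberTheory.Automorphic.ArchParameterUnique
import Literature.NumberTheory.Automorphic.AutomorphicRepsGLSatakeFlathProofs
import Literature.NumberTheory.Automorphic.GLnAdelicStructureProofs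
import Literature.NumberTheory.GaloisRepresentations.WeakAbelianDirectSummandCyclotomicProofs

/-!
# Line `reducible-companion-dispatch` — PROOF of the crux `IrreducibilityBySelfDuality.IrreducibleGL3CM`
(crux item stmt-Langlands-14327, rank 9; route `route-Langlands-IrreducibilityBySelfDuality`)

Crux (FIXED, by name): `IrreducibleGL3CM` — THE SECTOR THEOREM in the summit's normalisation, as a pure
implication of the route's three cruxes (`RegularAdjointLiftCM`, `EssSelfDualIrreducibleCM`,
`ReducibleForcesEssSelfDual`) and six inputs (`GaloisRepOfRegularAlgebraic`, `WeakAbelianSummandHecke`,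
`SelfdualGL3AdjointLift`, `PairLBoundaryJS`, `ContragredientDatum`, `HeckeEigenvalueField`): for `K` CM,
`π` cuspidal on `GL_3(𝔸_K)`, L-algebraic with a REGULAR infinity type, every `ℓ`, `ι` and EVERY
`ρ : Γ_K → GL_3(ℚ̄_ℓ)` (not assumed semisimple) with `SatakeFrobCompatibleAt ι π ρ v` for almost all `v`
(arithmetic-Frobenius roots `ι⁻¹(α_j⁻¹)`, `m = 1`) is irreducible.

Idea (line card `Lines/reducible-companion-dispatch.md`, triage r1 k=1: pass): dispatch through a SEMISIMPLE
COMPANION in the cruxes' normalisation. (i) `n = 3` odd: L-algebraic + regular infinity type ⇒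
`IsRegularAlgebraic` (`isCAlgebraic_iff_isLAlgebraic_of_odd`, `HasInfinityType.map_a_eq`; proved below);
(ii) `ρ' = ρ ⊗ χ_ℓ⁻¹` is compatible in the C-normalisation `arithFrobPolyOfSatake ι q_v 3 α` (roots
`q_v⁻¹ ι⁻¹(α_j⁻¹)`, `χ_ℓ(Frob_v) = q_v`) and is irreducible iff `ρ` is (`stub_cyclotomicUntwist`);
(iii) a CONTINUOUS semisimplification `r` of `ρ'` with the same characteristic polynomials and
`ker ρ' ≤ ker r` (`stub_continuousSemisimplification`) is again compatible a.e. (Satake uniqueness,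
`hasSatakeParamAt_unique_holds`, turns the summit's `∃ α` clause into the cruxes' `∀ α` clause); (iv) if `ρ`
were reducible then so is `ρ'`, hence so is `r` (Brauer–Nesbitt with characteristic polynomials,
`stub_not_isIrreducible_of_charpoly_eq`), while `ReducibleForcesEssSelfDual` (fed with the four inputs BY
DEFEQ) makes `π` essentially self-dual at Satake level and excludes three stable lines, and then
`EssSelfDualIrreducibleCM` (fed with lang.S27, Ramakrishnan Thm A and `RegularAdjointLiftCM`) makes `r`
irreducible — contradiction.

## Stubs (3, registered on stmt-Langlands-14327, all LANDED as `--supports` files and imported here)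
* `stub_cyclotomicUntwist` (M) — the cyclotomic untwist `ρ ↦ ρ ⊗ χ_ℓ⁻¹` on rank-3 framed Galois
  representations over `ℚ̄_ℓ`: irreducibility transfers back, unramifiedness away from `ℓ` is kept, and the
  `m = 1` Frobenius characteristic polynomial becomes the `m = 3` one (tree: `FramedRep.twist`,
  `exists_cyclotomic_padicAlgCl`, `GaloisRep.cyclotomicCharacter_apply_of_isArithFrobAt`,
  `FramedGaloisRep.isUnramifiedAt_cyclotomic_holds`, `isIrreducible_of_twist`).
* `stub_continuousSemisimplification` (M–L, hardest; the lead's) — every-rank CONTINUOUS semisimplification of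
  a framed representation: semisimple, same `det(X - r g)`, `r₀ g = 1 → r g = 1` (tree: the abstract
  `Literature.RepresentationTheory.Semisimple.exists_semisimplification` and the continuous rank-2
  `FramedGaloisRep.exists_semisimplification_two`; here the dévissage is re-run keeping the diagonal
  blocks continuous for the units topology of `GL`).
* `stub_not_isIrreducible_of_charpoly_eq` (M) — a semisimple `r` with the characteristic polynomials of a
  reducible `r₀` is reducible (Brauer–Nesbitt with characteristic polynomials,
  `Representation.nonempty_equiv_of_charpoly_eq`, against a product semisimplification `S' × Q'` of `r₀`,
  `Module.exists_isSemisimpleModule_charpoly_smul_eq`, which is not simple).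
* `IrreducibleGL3CM_of : IrreducibleGL3CM` — the kernel-checked composition (no hypothesis: every input is an
  antecedent of the crux itself).

## Disproof used
None published for this crux (no `Disproof.lean` / `Negative/` lemma existed while the line was built; item
evidence: TRIAGE-r1-1.md, Bridge.lean, the planner's line card/skeleton — reconstructed from the registered
stub signatures).
-/

noncomputable section

-- (H5 of `AutomorphicRepsGL`) the place subtypes indexing the factors of `mixedSpace K` are `Fintype` classically
open scoped NumberField Classical
open Filter IsDedekindDomain
open Literature.NumberTheory.Automorphic Literature.NumberTheory.GaloisRepresentations
open Summit.Langlands.Langlands.Theses.IrreducibilityBySelfDuality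

namespace Summit.Langlands.Langlands.Theorems.IrreducibleGL3CM

/-! ### The three stubs (all LANDED as `--supports` files of stmt-Langlands-14327, imported above)

* `stub_cyclotomicUntwist` — `Theorems/IrreducibilityBySelfDualityIrreducibleGL3CMCyclotomicUntwist.lean`;
* `stub_continuousSemisimplification` — `Theorems/IrreducibilityBySelfDualityIrreducibleGL3CMContinuousSemisimplification.lean` (p70715);
* `stub_not_isIrreducible_of_charpoly_eq` — `Theorems/IrreducibilityBySelfDualityIrreducibleGL3CMReducibleCompanion.lean`.
The names below resolve to the landed theorems (same namespace). -/

/-! ### Bridge (i): odd rank, L-algebraic with a regular infinity type is regular algebraic -/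

/-- For `π` on `GL_3` (odd rank), L-algebraic together with SOME regular infinity type gives Clozel's
regular algebraicity: an L-algebraic infinity type `T₁` of `π` is C-algebraic (`n = 3` odd,
`InfinityType.isCAlgebraic_iff_isLAlgebraic_of_odd`) and regular, because regularity only reads the
`a`-multisets, which are the same for all infinity types of `π` (`HasInfinityType.map_a_eq`). -/
theorem isRegularAlgebraic_of_isLAlgebraic_of_isRegular {K : Type} [Field K] [NumberField K]
    {hcpt : isCompact_glFiniteIntegralLevel 3 K} (π : AutomorphicRepData (AutomorphyDatum.gl 3 K hcpt))
    (hL : π.IsLAlgebraic) (hT : ∃ T : InfinityType K 3, π.HasInfinityType T ∧ T.IsRegular) :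
    π.IsRegularAlgebraic := by
  obtain ⟨T₁, hT₁, hL₁⟩ := hL
  obtain ⟨T₂, hT₂, hR₂⟩ := hT
  refine ⟨T₁, hT₁, ?_, fun σ => ?_⟩
  · exact (InfinityType.isCAlgebraic_iff_isLAlgebraic_of_odd (by decide : Odd 3) T₁).mpr hL₁
  · rw [AutomorphicRepData.HasInfinityType.map_a_eq π hT₁ hT₂ σ]
    exact hR₂ σ

/-! ### The composition -/

/-- **The crux from its stubs.** `IrreducibleGL3CM` (by name) follows from the three stubs: regular
algebraicity by bridge (i); the cyclotomic untwist `ρ'` of `ρ` (stub 1) is compatible with `(π, ι)` at almost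
all places in the `m = 3` normalisation (Satake parameters are unique, `hasSatakeParamAt_unique_holds`, and
`v ∤ ℓ` eventually, `eventually_natCast_not_mem`); its continuous semisimplification `r` (stub 2) is
compatible as well (same characteristic polynomials, smaller kernel); if `ρ` were reducible then so would be
`ρ'` and `r` (stub 3), contradicting `ReducibleForcesEssSelfDual` + `EssSelfDualIrreducibleCM` fed with the
six inputs by definitional unfolding (level-1 witness from `isCompact_glFiniteIntegralLevel_holds`). -/
theorem IrreducibleGL3CM_of : IrreducibleGL3CM := by
  intro hRAL hES hRF hGR hWA hSD hPL hCD hHE K _ _ hCM hcpt π hL hT ℓ _ ι ρ h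
  -- (i) regular algebraicity
  have hRA : π.1.IsRegularAlgebraic := isRegularAlgebraic_of_isLAlgebraic_of_isRegular π.1 hL hT
  -- (ii) the cyclotomic untwist, compatible a.e. in the `m = 3` normalisation
  obtain ⟨ρ', himp, hρ'v⟩ := stub_cyclotomicUntwist K ℓ ι ρ
  have hρ' : ∀ᶠ v : HeightOneSpectrum (𝓞 K) in cofinite, ∀ α : Multiset ℂ, π.1.HasSatakeParamAt v α →
      ρ'.IsUnramifiedAt v ∧ ρ'.HasFrobCharpolyAt v (arithFrobPolyOfSatake ι v.residueCard 3 α) := by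
    filter_upwards [h, FramedGaloisRep.eventually_natCast_not_mem K ℓ] with v hv hℓ
    obtain ⟨α₀, hα₀, hur, hcp⟩ := hv
    intro α hα
    obtain rfl : α = α₀ := AutomorphicRepData.hasSatakeParamAt_unique_holds π.1 hα hα₀
    obtain ⟨hur', hcp'⟩ := hρ'v v hℓ hur
    exact ⟨hur', hcp' α hcp⟩
  -- (iii) the continuous semisimplification, still compatible a.e.
  obtain ⟨r, hrss, hrcp, hrker⟩ := stub_continuousSemisimplification K ℓ 3 ρ'
  have hr : ∀ᶠ v : HeightOneSpectrum (𝓞 K) in cofinite, ∀ α : Multiset ℂ, π.1.HasSatakeParamAt v α →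
      r.IsUnramifiedAt v ∧ r.HasFrobCharpolyAt v (arithFrobPolyOfSatake ι v.residueCard 3 α) := by
    filter_upwards [hρ'] with v hv α hα
    obtain ⟨hur, hcp⟩ := hv α hα
    exact ⟨fun 𝔓 h𝔓 σ hσ => hrker σ (hur 𝔓 h𝔓 σ hσ),
      fun 𝔓 h𝔓 σ hσ => (hrcp σ).trans (hcp 𝔓 h𝔓 σ hσ)⟩
  -- (iv) dispatch
  by_contra hirr
  have hρ'irr : ¬ ρ'.toGaloisRep.IsIrreducible := fun h' => hirr (himp h')
  have hrirr : ¬ r.toGaloisRep.IsIrreducible :=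
    stub_not_isIrreducible_of_charpoly_eq K ℓ 3 ρ' r hrss hrcp hρ'irr
  have h1 : isCompact_glFiniteIntegralLevel 1 K := isCompact_glFiniteIntegralLevel_holds 1 K
  obtain ⟨hess, h3⟩ := hRF hWA hHE hPL hCD K h1 hcpt π hRA ℓ ι r hrss hr
  exact hrirr (hES hGR hSD hRAL K hCM h1 hcpt π hRA (hess hrirr) ℓ ι r hrss hr h3)

end Summit.Langlands.Langlands.Theorems.IrreducibleGL3CM

namespace Summit.Langlands.Langlands.Theorems

/-- **`IrreducibleGL3CM` holds** (item stmt-Langlands-14327 of route `IrreducibilityBySelfDuality`): the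
sector theorem — for `K` CM, `π` cuspidal on `GL_3(𝔸_K)`, L-algebraic with a regular infinity type, every
`ρ : Γ_K → GL_3(ℚ̄_ℓ)` Satake–Frobenius compatible with `(π, ι)` at almost all places is irreducible — as an
implication of the route's three cruxes and six inputs.  Alias of `IrreducibleGL3CM.IrreducibleGL3CM_of`
(line `reducible-companion-dispatch`). -/
theorem IrreducibleGL3CM_proof : IrreducibleGL3CM :=
  IrreducibleGL3CM.IrreducibleGL3CM_of

end Summit.Langlands.Langlands.Theorems

end
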